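import Mathlib.Algebra.BigOperators.Ring.Finset
import Mathlib.Algebra.Group.Pointwise.Finset.Basic
import Mathlib.Algebra.Group.Subgroup.Finite
import Mathlib.Tactic.Abel
import Mathlib.Tactic.Ring
import HarnessLib

/-!
# Every part of a three-set cube form spans `A` affinely (coset lemma)

ω-census `pub-omega`, family (b3), seat pub-omega-group gen 32.  Framing: lottery ticket; floor = certified bounds/negative
ranges.  VALUE: kernel structure theorems about the group-theoretic method (three-set cube law triples in dihedral-like
groups); NOT progress on ω.

The *cube symmetric form* `(W, X, Y, x₀)` over a finite abelian group `A` is the conclusion of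
`CubeSymmetricForm.cube_symmetric_form_of_law`: the three signed sums `−w+x+y`, `w−x+y`, `w+x−y` are injective on
`W × X × Y`, with pairwise disjoint images covering `A ∖ {x₀}`.

* `cube_form_count_eq` — the pointwise form: for every `a`, the three representation counts of `a` add up to `[a ≠ x₀]`.
* `three_mul_card_add_one_eq` — `3|W||X||Y| + 1 = |A|`.
* **`card_eq_one_of_subset_coset`** — if `W` lies in a coset `w₀ + H` of a PROPER subgroup `H`, then `|W| = 1`:
  summing the pointwise form over a coset `C` of `H`, each of the three counts becomes `|W| ·` (a number of pairs
  `(x, y)`), because `−w+x+y ∈ C` does not depend on `w ∈ w₀ + H`; so `|W|` divides `|C ∖ {x₀}|`, which is `|H|` for a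
  coset avoiding `x₀` (one exists since `H ≠ A`) and `|H| − 1` for the coset of `x₀`.  Hence every part with at least two
  points spans `A` affinely (`exists_sub_notMem_of_two_le_card`); the same holds for `X` and `Y` by the rotation
  symmetry `ThreeSetPartThreeNormalForm.cube_symmetric_form_rotate`.  (RESULTS-g31 §1 stated the weaker 'a part inside a
  coset of `H` has size dividing `|H|`' without proof; this is its kernel form.)

Consequences for `A = ℤ_p × ℤ_p` (a part of size `3` is a non-degenerate triangle, normal form `W = {0, e₁, e₂}`,
`9|X||Y| + 1 = p²`) are in `ThreeSetPartThreeNormalForm.lean`.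
Design: hypotheses are kept in the unbundled seven-conjunct form of `cube_symmetric_form_of_law` /
`ThreeSetLineSymmetry.cube_symmetric_form_translate` so that the lemmas compose with those files.  No new definitions.
-/

namespace Summit.MatrixMultiplication.OmegaCensus

open Finset

section General

variable {A : Type*} [AddCommGroup A] [DecidableEq A]

omit [AddCommGroup A] in
/-- For a function injective on `s`, the fibre of `a` in `s` has one element if `a` is in the image and none otherwise.
[folklore] -/
theorem card_filter_eq_ite_of_injOn {ι : Type*} [DecidableEq ι] {s : Finset ι} {f : ι → A} (hf : Set.InjOn f ↑s)
    (a : A) : (s.filter fun i => f i = a).card = if a ∈ s.image f then 1 else 0 := by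
  split_ifs with ha
  · obtain ⟨i, hi, rfl⟩ := mem_image.1 ha
    rw [card_eq_one]
    refine ⟨i, ?_⟩
    ext j
    simp only [mem_filter, mem_singleton]
    exact ⟨fun h => hf h.1 hi h.2, fun h => by subst h; exact ⟨hi, rfl⟩⟩
  · rw [card_eq_zero, filter_eq_empty_iff]
    exact fun i hi h => ha (mem_image.2 ⟨i, hi, h⟩)

omit [AddCommGroup A] in
/-- Indicators of three pairwise disjoint finsets add up to the indicator of their union. [folklore] -/
theorem ite_mem_add_three {P Q R : Finset A} (hPQ : Disjoint P Q) (hPR : Disjoint P R) (hQR : Disjoint Q R) (a : A) :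
    ((if a ∈ P then 1 else 0) + (if a ∈ Q then 1 else 0) + (if a ∈ R then 1 else 0) : ℕ) =
      if a ∈ P ∪ Q ∪ R then 1 else 0 := by
  by_cases hP : a ∈ P
  · have hQ : a ∉ Q := fun h => disjoint_left.1 hPQ hP h
    have hR : a ∉ R := fun h => disjoint_left.1 hPR hP h
    simp [hP, hQ, hR]
  · by_cases hQ : a ∈ Q
    · have hR : a ∉ R := fun h => disjoint_left.1 hQR hQ h
      simp [hP, hQ, hR]
    · by_cases hR : a ∈ R <;> simp [hP, hQ, hR]

variable [Fintype A]

/-- **Pointwise form of the cube symmetric form.**  For every `a`, the numbers of representations of `a` as `−w+x+y`,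
`w−x+y`, `w+x−y` (`(w,x,y) ∈ W × X × Y`) add up to `1` if `a ≠ x₀` and to `0` if `a = x₀`. [folklore] -/
theorem cube_form_count_eq {W X Y : Finset A} {x₀ : A}
    (h₁ : Set.InjOn (fun p : A × A × A => -p.1 + p.2.1 + p.2.2) ↑(W ×ˢ X ×ˢ Y))
    (h₂ : Set.InjOn (fun p : A × A × A => p.1 - p.2.1 + p.2.2) ↑(W ×ˢ X ×ˢ Y))
    (h₃ : Set.InjOn (fun p : A × A × A => p.1 + p.2.1 - p.2.2) ↑(W ×ˢ X ×ˢ Y))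
    (d₁₂ : Disjoint ((W ×ˢ X ×ˢ Y).image fun p : A × A × A => -p.1 + p.2.1 + p.2.2)
      ((W ×ˢ X ×ˢ Y).image fun p : A × A × A => p.1 - p.2.1 + p.2.2))
    (d₁₃ : Disjoint ((W ×ˢ X ×ˢ Y).image fun p : A × A × A => -p.1 + p.2.1 + p.2.2)
      ((W ×ˢ X ×ˢ Y).image fun p : A × A × A => p.1 + p.2.1 - p.2.2))
    (d₂₃ : Disjoint ((W ×ˢ X ×ˢ Y).image fun p : A × A × A => p.1 - p.2.1 + p.2.2)
      ((W ×ˢ X ×ˢ Y).image fun p : A × A × A => p.1 + p.2.1 - p.2.2))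
    (hcover : ((W ×ˢ X ×ˢ Y).image fun p : A × A × A => -p.1 + p.2.1 + p.2.2) ∪
      ((W ×ˢ X ×ˢ Y).image fun p : A × A × A => p.1 - p.2.1 + p.2.2) ∪
      ((W ×ˢ X ×ˢ Y).image fun p : A × A × A => p.1 + p.2.1 - p.2.2) = univ.erase x₀) (a : A) :
    ((W ×ˢ X ×ˢ Y).filter fun p : A × A × A => -p.1 + p.2.1 + p.2.2 = a).card +
      ((W ×ˢ X ×ˢ Y).filter fun p : A × A × A => p.1 - p.2.1 + p.2.2 = a).card +
      ((W ×ˢ X ×ˢ Y).filter fun p : A × A × A => p.1 + p.2.1 - p.2.2 = a).card = if a = x₀ then 0 else 1 := by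
  rw [card_filter_eq_ite_of_injOn h₁, card_filter_eq_ite_of_injOn h₂, card_filter_eq_ite_of_injOn h₃,
    ite_mem_add_three d₁₂ d₁₃ d₂₃, hcover]
  by_cases ha : a = x₀ <;> simp [ha]

/-- **Counting identity** `3|W||X||Y| + 1 = |A|` of the cube symmetric form. [folklore] -/
theorem three_mul_card_add_one_eq {W X Y : Finset A} {x₀ : A}
    (h₁ : Set.InjOn (fun p : A × A × A => -p.1 + p.2.1 + p.2.2) ↑(W ×ˢ X ×ˢ Y))
    (h₂ : Set.InjOn (fun p : A × A × A => p.1 - p.2.1 + p.2.2) ↑(W ×ˢ X ×ˢ Y))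
    (h₃ : Set.InjOn (fun p : A × A × A => p.1 + p.2.1 - p.2.2) ↑(W ×ˢ X ×ˢ Y))
    (d₁₂ : Disjoint ((W ×ˢ X ×ˢ Y).image fun p : A × A × A => -p.1 + p.2.1 + p.2.2)
      ((W ×ˢ X ×ˢ Y).image fun p : A × A × A => p.1 - p.2.1 + p.2.2))
    (d₁₃ : Disjoint ((W ×ˢ X ×ˢ Y).image fun p : A × A × A => -p.1 + p.2.1 + p.2.2)
      ((W ×ˢ X ×ˢ Y).image fun p : A × A × A => p.1 + p.2.1 - p.2.2))
    (d₂₃ : Disjoint ((W ×ˢ X ×ˢ Y).image fun p : A × A × A => p.1 - p.2.1 + p.2.2)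
      ((W ×ˢ X ×ˢ Y).image fun p : A × A × A => p.1 + p.2.1 - p.2.2))
    (hcover : ((W ×ˢ X ×ˢ Y).image fun p : A × A × A => -p.1 + p.2.1 + p.2.2) ∪
      ((W ×ˢ X ×ˢ Y).image fun p : A × A × A => p.1 - p.2.1 + p.2.2) ∪
      ((W ×ˢ X ×ˢ Y).image fun p : A × A × A => p.1 + p.2.1 - p.2.2) = univ.erase x₀) :
    3 * (W.card * X.card * Y.card) + 1 = Fintype.card A := by
  have hc := congrArg Finset.card hcover
  rw [card_union_of_disjoint (disjoint_union_left.2 ⟨d₁₃, d₂₃⟩), card_union_of_disjoint d₁₂,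
    card_image_of_injOn h₁, card_image_of_injOn h₂, card_image_of_injOn h₃, card_product, card_product,
    card_erase_of_mem (mem_univ x₀), card_univ, ← mul_assoc] at hc
  have hpos : 0 < Fintype.card A := Fintype.card_pos
  omega

end General

section Coset

variable {A : Type*} [AddCommGroup A] [DecidableEq A] [Fintype A]

omit [AddCommGroup A] [Fintype A] in
/-- Summing fibre cardinalities over a set `C` of values counts the elements mapped into `C`. [folklore] -/
theorem sum_card_filter_eq_card_filter_mem {ι : Type*} (s : Finset ι) (f : ι → A) (C : Finset A) :
    ∑ a ∈ C, (s.filter fun i => f i = a).card = (s.filter fun i => f i ∈ C).card := by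
  rw [card_eq_sum_card_fiberwise (f := f) (s := s.filter fun i => f i ∈ C) (t := C)
    (fun i hi => (mem_filter.1 (mem_coe.1 hi)).2)]
  refine sum_congr rfl fun a ha => ?_
  congr 1
  ext i
  simp only [mem_filter]
  exact ⟨fun h => ⟨⟨h.1, h.2 ▸ ha⟩, h.2⟩, fun h => ⟨h.1.1, h.2⟩⟩

/-- **Coset lemma.**  In a cube symmetric form `(W, X, Y, x₀)`, a part `W` contained in a coset `w₀ + H` of a proper
subgroup `H < A` is a singleton.  Proof: summing the pointwise form `cube_form_count_eq` over a coset `C = b + H`, the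
condition `−w+x+y ∈ C` does not depend on `w ∈ w₀ + H` (and likewise for the other two signed sums), so
`|W| · N_b = |C ∖ {x₀}|`; this is `|H| − 1` for `b = x₀` and `|H|` for a coset avoiding `x₀`, whence `|W| ∣ 1`. [folklore] -/
theorem card_eq_one_of_subset_coset {W X Y : Finset A} {x₀ : A}
    (h₁ : Set.InjOn (fun p : A × A × A => -p.1 + p.2.1 + p.2.2) ↑(W ×ˢ X ×ˢ Y))
    (h₂ : Set.InjOn (fun p : A × A × A => p.1 - p.2.1 + p.2.2) ↑(W ×ˢ X ×ˢ Y))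
    (h₃ : Set.InjOn (fun p : A × A × A => p.1 + p.2.1 - p.2.2) ↑(W ×ˢ X ×ˢ Y))
    (d₁₂ : Disjoint ((W ×ˢ X ×ˢ Y).image fun p : A × A × A => -p.1 + p.2.1 + p.2.2)
      ((W ×ˢ X ×ˢ Y).image fun p : A × A × A => p.1 - p.2.1 + p.2.2))
    (d₁₃ : Disjoint ((W ×ˢ X ×ˢ Y).image fun p : A × A × A => -p.1 + p.2.1 + p.2.2)
      ((W ×ˢ X ×ˢ Y).image fun p : A × A × A => p.1 + p.2.1 - p.2.2))
    (d₂₃ : Disjoint ((W ×ˢ X ×ˢ Y).image fun p : A × A × A => p.1 - p.2.1 + p.2.2)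
      ((W ×ˢ X ×ˢ Y).image fun p : A × A × A => p.1 + p.2.1 - p.2.2))
    (hcover : ((W ×ˢ X ×ˢ Y).image fun p : A × A × A => -p.1 + p.2.1 + p.2.2) ∪
      ((W ×ˢ X ×ˢ Y).image fun p : A × A × A => p.1 - p.2.1 + p.2.2) ∪
      ((W ×ˢ X ×ˢ Y).image fun p : A × A × A => p.1 + p.2.1 - p.2.2) = univ.erase x₀)
    (H : AddSubgroup A) (hH : H ≠ ⊤) (w₀ : A) (hW : ∀ w ∈ W, w - w₀ ∈ H) : W.card = 1 := by
  classical
  set h := (univ.filter fun a : A => a ∈ H).card with hh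
  -- the coset `b + H` as a finset, its size, and the size of its punctured version
  have hC : ∀ b : A, (univ.filter fun a : A => a - b ∈ H).card = h := by
    intro b
    have : (univ.filter fun a : A => a - b ∈ H) = (univ.filter fun a : A => a ∈ H).image (· + b) := by
      ext a
      simp only [mem_filter, mem_univ, true_and, mem_image]
      exact ⟨fun ha => ⟨a - b, ha, sub_add_cancel a b⟩, fun ⟨c, hc, hca⟩ => by rw [← hca, add_sub_cancel_right]; exact hc⟩
    rw [this, card_image_of_injective _ (add_left_injective b)]
  -- key divisibility
  have key : ∀ b : A, W.card ∣ ((univ.filter fun a : A => a - b ∈ H).erase x₀).card := by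
    intro b
    set C := univ.filter fun a : A => a - b ∈ H with hCdef
    have hsum : ∑ a ∈ C, (((W ×ˢ X ×ˢ Y).filter fun p : A × A × A => -p.1 + p.2.1 + p.2.2 = a).card +
        ((W ×ˢ X ×ˢ Y).filter fun p : A × A × A => p.1 - p.2.1 + p.2.2 = a).card +
        ((W ×ˢ X ×ˢ Y).filter fun p : A × A × A => p.1 + p.2.1 - p.2.2 = a).card) =
        ∑ a ∈ C, (if a = x₀ then 0 else 1 : ℕ) :=
      sum_congr rfl fun a _ => cube_form_count_eq h₁ h₂ h₃ d₁₂ d₁₃ d₂₃ hcover a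
    rw [sum_add_distrib, sum_add_distrib, sum_card_filter_eq_card_filter_mem, sum_card_filter_eq_card_filter_mem,
      sum_card_filter_eq_card_filter_mem] at hsum
    have hrhs : ∑ a ∈ C, (if a = x₀ then 0 else 1 : ℕ) = (C.erase x₀).card := by
      rw [← filter_ne', card_filter]
      exact sum_congr rfl fun a _ => by by_cases ha : a = x₀ <;> simp [ha]
    have hmemC : ∀ z : A, z ∈ C ↔ z - b ∈ H := fun z => by simp [hCdef]
    -- each of the three counts is `|W| ·` (a number of pairs)
    have e₁ : ((W ×ˢ X ×ˢ Y).filter fun p : A × A × A => -p.1 + p.2.1 + p.2.2 ∈ C) =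
        W ×ˢ ((X ×ˢ Y).filter fun q : A × A => -w₀ + q.1 + q.2 - b ∈ H) := by
      ext ⟨w, x, y⟩
      simp only [mem_filter, mem_product, hmemC]
      constructor
      · rintro ⟨⟨hw, hx, hy⟩, hm⟩
        refine ⟨hw, ⟨hx, hy⟩, ?_⟩
        rw [show -w₀ + x + y - b = (w - w₀) + (-w + x + y - b) by abel]
        exact H.add_mem (hW w hw) hm
      · rintro ⟨hw, ⟨hx, hy⟩, hm⟩
        refine ⟨⟨hw, hx, hy⟩, ?_⟩
        rw [show -w + x + y - b = -(w - w₀) + (-w₀ + x + y - b) by abel]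
        exact H.add_mem (H.neg_mem (hW w hw)) hm
    have e₂ : ((W ×ˢ X ×ˢ Y).filter fun p : A × A × A => p.1 - p.2.1 + p.2.2 ∈ C) =
        W ×ˢ ((X ×ˢ Y).filter fun q : A × A => w₀ - q.1 + q.2 - b ∈ H) := by
      ext ⟨w, x, y⟩
      simp only [mem_filter, mem_product, hmemC]
      constructor
      · rintro ⟨⟨hw, hx, hy⟩, hm⟩
        refine ⟨hw, ⟨hx, hy⟩, ?_⟩
        rw [show w₀ - x + y - b = -(w - w₀) + (w - x + y - b) by abel]
        exact H.add_mem (H.neg_mem (hW w hw)) hm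
      · rintro ⟨hw, ⟨hx, hy⟩, hm⟩
        refine ⟨⟨hw, hx, hy⟩, ?_⟩
        rw [show w - x + y - b = (w - w₀) + (w₀ - x + y - b) by abel]
        exact H.add_mem (hW w hw) hm
    have e₃ : ((W ×ˢ X ×ˢ Y).filter fun p : A × A × A => p.1 + p.2.1 - p.2.2 ∈ C) =
        W ×ˢ ((X ×ˢ Y).filter fun q : A × A => w₀ + q.1 - q.2 - b ∈ H) := by
      ext ⟨w, x, y⟩
      simp only [mem_filter, mem_product, hmemC]
      constructor
      · rintro ⟨⟨hw, hx, hy⟩, hm⟩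
        refine ⟨hw, ⟨hx, hy⟩, ?_⟩
        rw [show w₀ + x - y - b = -(w - w₀) + (w + x - y - b) by abel]
        exact H.add_mem (H.neg_mem (hW w hw)) hm
      · rintro ⟨hw, ⟨hx, hy⟩, hm⟩
        refine ⟨⟨hw, hx, hy⟩, ?_⟩
        rw [show w + x - y - b = (w - w₀) + (w₀ + x - y - b) by abel]
        exact H.add_mem (hW w hw) hm
    rw [e₁, e₂, e₃, card_product, card_product, card_product, ← mul_add, ← mul_add, hrhs] at hsum
    exact Dvd.intro _ hsum
  -- the coset of `x₀`: `|W| ∣ |H| − 1`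
  have k₁ := key x₀
  rw [card_erase_of_mem (by simp), hC] at k₁
  -- a coset avoiding `x₀`: `|W| ∣ |H|`
  obtain ⟨g, hg⟩ : ∃ g : A, g ∉ H := by
    by_contra hall
    push Not at hall
    exact hH (eq_top_iff.2 fun g _ => hall g)
  have k₂ := key (x₀ - g)
  rw [erase_eq_of_notMem (by simpa using hg), hC] at k₂
  have hpos : 1 ≤ h := by
    rw [hh]; exact card_pos.2 ⟨0, by simp [H.zero_mem]⟩
  have := Nat.dvd_sub k₂ k₁
  rw [show h - (h - 1) = 1 by omega] at this
  exact Nat.dvd_one.1 this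

/-- **Affine spanning.**  A part with at least two points is not contained in any coset of a proper subgroup: for every
`H < A` and every base point `w₀` some `w ∈ W` has `w − w₀ ∉ H`. [folklore] -/
theorem exists_sub_notMem_of_two_le_card {W X Y : Finset A} {x₀ : A}
    (h₁ : Set.InjOn (fun p : A × A × A => -p.1 + p.2.1 + p.2.2) ↑(W ×ˢ X ×ˢ Y))
    (h₂ : Set.InjOn (fun p : A × A × A => p.1 - p.2.1 + p.2.2) ↑(W ×ˢ X ×ˢ Y))
    (h₃ : Set.InjOn (fun p : A × A × A => p.1 + p.2.1 - p.2.2) ↑(W ×ˢ X ×ˢ Y))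
    (d₁₂ : Disjoint ((W ×ˢ X ×ˢ Y).image fun p : A × A × A => -p.1 + p.2.1 + p.2.2)
      ((W ×ˢ X ×ˢ Y).image fun p : A × A × A => p.1 - p.2.1 + p.2.2))
    (d₁₃ : Disjoint ((W ×ˢ X ×ˢ Y).image fun p : A × A × A => -p.1 + p.2.1 + p.2.2)
      ((W ×ˢ X ×ˢ Y).image fun p : A × A × A => p.1 + p.2.1 - p.2.2))
    (d₂₃ : Disjoint ((W ×ˢ X ×ˢ Y).image fun p : A × A × A => p.1 - p.2.1 + p.2.2)
      ((W ×ˢ X ×ˢ Y).image fun p : A × A × A => p.1 + p.2.1 - p.2.2))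
    (hcover : ((W ×ˢ X ×ˢ Y).image fun p : A × A × A => -p.1 + p.2.1 + p.2.2) ∪
      ((W ×ˢ X ×ˢ Y).image fun p : A × A × A => p.1 - p.2.1 + p.2.2) ∪
      ((W ×ˢ X ×ˢ Y).image fun p : A × A × A => p.1 + p.2.1 - p.2.2) = univ.erase x₀)
    (hW2 : 2 ≤ W.card) (H : AddSubgroup A) (hH : H ≠ ⊤) (w₀ : A) : ∃ w ∈ W, w - w₀ ∉ H := by
  by_contra hall
  push Not at hall
  have := card_eq_one_of_subset_coset h₁ h₂ h₃ d₁₂ d₁₃ d₂₃ hcover H hH w₀ hall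
  omega

end Coset

end Summit.MatrixMultiplication.OmegaCensus
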